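import Summits.SmoothPoincare4.SmoothPoincare4.Theorems.EntropyRungRicciFlowBlowupLimitOfCompactness
import Summits.SmoothPoincare4.SmoothPoincare4.Theorems.EntropyRungChangGurskyYangOfGvPathFacts
import Literature.Geometry.Riemannian.ChangGurskyYang
import Literature.Geometry.Riemannian.GurskyViaclovskyC2EstimateProofs
import HarnessLib

/-!
# Route EntropyRung · crux `ChangGurskyYang` — the crux modulo FOUR one-fact leaves
# (the Gursky–Viaclovsky `C²` estimate being a theorem of the tree)

Skeleton r10 of line `margerin-cone-hamilton-rails` (continuation lead c3, crux stmt-SmoothPoincare4-10834):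
of the five one-fact leaves of r9 (`EntropyRungChangGurskyYangOfFiveFacts.lean`, p117133) the a priori `C²`
estimate `gurskyViaclovsky_hessianEstimate_weighted_four` is now PROVED in the tree
(`gurskyViaclovsky_hessianEstimate_weighted_four_holds`, `GurskyViaclovskyC2EstimateProofs.lean`: the
cone reduction of the Hessian bound to a Laplacian bound, and Chen's maximum principle for `Δu + |∇u|²`
in charts). Feeding it in leaves FOUR named facts between the tree and Chang–Gursky–Yang's Theorem A:
Hamilton's compactness theorem for Ricci flows (time-zero slice) and the Gursky–Viaclovsky `C¹` estimate,
openness and closedness of the solvable set along the Weyl-weighted `σ₂` path. The same substitution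
turns CGY Thm. 1.4 (`changGurskyYang_theorem14_four`) into a consequence of the three remaining GV facts.
No `sorry`, no definition.
-/

noncomputable section

-- every `Summit.SmoothPoincare4.SmoothPoincare4.…` name repeats the summit = sub-problem segment (D-0017 layout)
set_option linter.dupNamespace false

namespace Summit.SmoothPoincare4.SmoothPoincare4.Theorems.MargerinRails

open Literature.Geometry.Riemannian
open Summit.SmoothPoincare4.SmoothPoincare4.Theses.EntropyRung (ChangGurskyYang)
open Summit.SmoothPoincare4.SmoothPoincare4.Theorems.GvContinuityPath
  (changGurskyYang_theorem14_four_of_gvPathFacts)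

/-- **CGY 2003 Thm. 1.4 (`α = 1`, connected `Y > 0` form, the tree's named fact
`changGurskyYang_theorem14_four`) from the THREE remaining Gursky–Viaclovsky facts** — `C¹` estimate,
openness, closedness — the `C²` estimate being supplied by the tree theorem
`gurskyViaclovsky_hessianEstimate_weighted_four_holds`; via line `gv-continuity-path`'s
`changGurskyYang_theorem14_four_of_gvPathFacts` (p108727).
[cite: ChangGurskyYang2003, Thm. 1.4] [cite: GurskyViaclovsky2003, Props. 2, 5, 6 and §5] -/
theorem changGurskyYang_theorem14_four_of_threeGvFacts :
    gurskyViaclovsky_gradientEstimate_weighted_four → gurskyViaclovsky_pathOpen_weighted_four →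
    gurskyViaclovsky_pathClosed_weighted_four → changGurskyYang_theorem14_four :=
  fun hG hO hC ↦ changGurskyYang_theorem14_four_of_gvPathFacts hG
    gurskyViaclovsky_hessianEstimate_weighted_four_holds hO hC

/-- **The crux `EntropyRung.ChangGurskyYang` from its FOUR remaining one-fact leaves**: Hamilton's 1995
compactness theorem (time-zero slice, Morgan–Tian volume form) and the Gursky–Viaclovsky `C¹` estimate,
openness and closedness along the Weyl-weighted path — `ChangGurskyYang_of_hamiltonCompactness_of_theorem14`
(p115618) after `changGurskyYang_theorem14_four_of_threeGvFacts`; equivalently `ChangGurskyYang_of_fiveFacts`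
(p117133) with the `C²` estimate discharged by `gurskyViaclovsky_hessianEstimate_weighted_four_holds`.
[cite: ChangGurskyYang2003, §2, p. 121] [cite: Hamilton1995Compactness, Thm. 1.2]
[cite: GurskyViaclovsky2003, Props. 2, 5 and §5] -/
theorem ChangGurskyYang_of_fourFacts :
    hamilton_compactness_ricciFlow_slice_four →
    gurskyViaclovsky_gradientEstimate_weighted_four → gurskyViaclovsky_pathOpen_weighted_four →
    gurskyViaclovsky_pathClosed_weighted_four → ChangGurskyYang :=
  fun hF hG hO hC ↦ ChangGurskyYang_of_hamiltonCompactness_of_theorem14 hF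
    (changGurskyYang_theorem14_four_of_threeGvFacts hG hO hC)

/-- The same for the item's second route decl `WeylBudget.ChangGurskyYang` (the same proposition).
[cite: ChangGurskyYang2003, Thm. A] -/
theorem ChangGurskyYang_weylBudget_of_fourFacts :
    hamilton_compactness_ricciFlow_slice_four →
    gurskyViaclovsky_gradientEstimate_weighted_four → gurskyViaclovsky_pathOpen_weighted_four →
    gurskyViaclovsky_pathClosed_weighted_four →
      Summit.SmoothPoincare4.SmoothPoincare4.Theses.WeylBudget.ChangGurskyYang :=
  ChangGurskyYang_of_fourFacts

/-- **The Literature named fact `changGurskyYang_sphere_four` (CGY 2003 Thm. A, simply connected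
`scal > 0` case) from the same four facts**, for the fact's other consumers.
[cite: ChangGurskyYang2003, Thm. A and §2, p. 121] -/
theorem changGurskyYang_sphere_four_of_fourFacts :
    hamilton_compactness_ricciFlow_slice_four →
    gurskyViaclovsky_gradientEstimate_weighted_four → gurskyViaclovsky_pathOpen_weighted_four →
    gurskyViaclovsky_pathClosed_weighted_four → changGurskyYang_sphere_four :=
  ChangGurskyYang_of_fourFacts

end Summit.SmoothPoincare4.SmoothPoincare4.Theorems.MargerinRails

end
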